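import Mathlib
import Summits.Ventures.PercRepro2.Independence
import Summits.Ventures.PercRepro2.Harris
import Summits.Ventures.PercRepro2.HCov
import Summits.Ventures.PercRepro2.HCovDiag
import Summits.Ventures.PercRepro2.CutVertexPaths
import Summits.Ventures.PercRepro2.CutOneFarConn
import Summits.Ventures.PercRepro2.CutTwoFarConn
import Summits.Ventures.PercRepro2.CutTwoFarLaw
import Summits.Ventures.PercRepro2.CutTwoFar
import Summits.Ventures.PercRepro2.CutTwoFarHarris
import Summits.Ventures.PercRepro2.CutTwoFarRootsLaw
import Summits.Ventures.PercRepro2.CutTwoFarRightPat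
import Summits.Ventures.PercRepro2.CutTwoFarOBConn
import Summits.Ventures.PercRepro2.CutTwoFarOBMasses

/-!
# `o` and `b` behind a cut vertex, III: THE DIAGONAL REDUCTION (blind cell PercRepro2,
typer-1 g50)

The class theorem T3 of MINE2-CUTVERTEX.md §13.2 (S3.5, the role pair `{o, b}`) in the kernel:
with `v` a cut vertex, `o, b` on the left and the roots and `a₃` on the right (or at `v`),

  `Gc = P₁ P₂ · Θ + (q_all − P₁ P₂) · 2 · P(Q) · D · P(Q, v and a₃ on opposite sides)`

(**`Gc_obFar_eq`**), where `P₁ = P_A(o ↔ v) = q_all + q_x1`, `P₂ = P_A(b ↔ v) = q_all + q_x2`,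
`q_all = P_A(o ↔ v, b ↔ v)` and `Θ = Gc(o := v, b := v)` is the DIAGONAL instance of the same
graph.  Hence (HCOV) on the whole class (**`HCov_obFar`**): `Θ ≥ 0` is the diagonal theorem
(`HCovDiag.Gc_diag_nonneg`), `q_all − P₁ P₂ ≥ 0` is Harris on the part (`harris_x1_x2`), and the
rest is a product of probabilities.  Proof: the bilinear forms of Part II, `∑ q = 1`, `∑ r = 1`,
and `ring`.  Own work; standard axioms.
-/

namespace Summit.Ventures.PercRepro2

open CovForm CutVertexM9 UnionCluster

namespace CutTwoFar

section OBFar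

variable {V : Type*} {E : Type*} [Fintype E] [DecidableEq E] {R : Type*} [Field R]
variable {ends : E → Sym2 V} {side : E → Bool} {L : Set V} {v : V} {Rt : Set V}
variable (h : CutVertex ends side L v Rt) {o b a₁ a₂ a₃ : V} (p : E → R)
include h

/-- **T3 — THE DIAGONAL REDUCTION** (MINE2-CUTVERTEX §13.2; S3.5 `{o, b}`): with `o, b` behind the
cut vertex `v`, `Gc = P₁ P₂ · Gc(o := v, b := v) + (q_all − P₁ P₂) · 2 · P(Q) · D · P(Q, v ∈ U, a₃ ∈ U,
opposite sides)`, `P₁ = q_all + q_x1 = P_A(o ↔ v)`, `P₂ = q_all + q_x2 = P_A(b ↔ v)`. -/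
theorem Gc_obFar_eq (ho : o ∈ L ∨ o = v) (hb : b ∈ L ∨ b = v) (h1 : a₁ ∈ Rt ∨ a₁ = v)
    (h2 : a₂ ∈ Rt ∨ a₂ = v) (h3 : a₃ ∈ Rt ∨ a₃ = v) : Gc p ends o a₁ a₂ a₃ b =
    (patProb ends side v o b p ![true, true, true] + patProb ends side v o b p ![true, false, false]) * (patProb ends side v o b p ![true, true, true] + patProb ends side v o b p ![false, true, false]) * Gc p ends v a₁ a₂ a₃ v +
      (patProb ends side v o b p ![true, true, true] - (patProb ends side v o b p ![true, true, true] + patProb ends side v o b p ![true, false, false]) * (patProb ends side v o b p ![true, true, true] + patProb ends side v o b p ![false, true, false])) *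
        (2 * prob p (avoidAll ends a₂ {a₁}) * prob p (PDEvent ends a₁ a₂ a₃) *
          prob p (avoidAll ends a₂ {a₁} ∩ ((connEvent ends a₁ v ∩ connEvent ends a₂ a₃) ∪ (connEvent ends a₂ v ∩ connEvent ends a₁ a₃)))) := by
  have hq := sum_patProb_transPatterns ends side v o b p
  rw [sum_transPatterns] at hq
  have hr := ratom_sum_transSix ends side v a₁ a₂ a₃ p
  rw [sum_transSix] at hr
  have hqs : patProb ends side v o b p ![false, false, false] = 1 - (patProb ends side v o b p ![true, true, true] + patProb ends side v o b p ![true, false, false] + patProb ends side v o b p ![false, true, false] + patProb ends side v o b p ![false, false, true]) := by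
    linear_combination hq
  have hrs : ratom ends side v a₁ a₂ a₃ p ![false, false, false, false, false, false] = 1 - (ratom ends side v a₁ a₂ a₃ p ![true, true, true, true, true, true] + ratom ends side v a₁ a₂ a₃ p ![true, true, false, true, false, false] + ratom ends side v a₁ a₂ a₃ p ![true, false, true, false, true, false] + ratom ends side v a₁ a₂ a₃ p ![true, false, false, false, false, true] + ratom ends side v a₁ a₂ a₃ p ![true, false, false, false, false, false] + ratom ends side v a₁ a₂ a₃ p ![false, true, true, false, false, true] + ratom ends side v a₁ a₂ a₃ p ![false, true, false, false, true, false] + ratom ends side v a₁ a₂ a₃ p ![false, true, false, false, false, false] + ratom ends side v a₁ a₂ a₃ p ![false, false, true, true, false, false] + ratom ends side v a₁ a₂ a₃ p ![false, false, true, false, false, false] + ratom ends side v a₁ a₂ a₃ p ![false, false, false, true, true, true] + ratom ends side v a₁ a₂ a₃ p ![false, false, false, true, false, false] + ratom ends side v a₁ a₂ a₃ p ![false, false, false, false, true, false] + ratom ends side v a₁ a₂ a₃ p ![false, false, false, false, false, true]) := by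
    linear_combination hr
  simp only [Gc, DEF]
  rw [PQ_ob h p h1 h2,
    D_ob h p h1 h2 h3,
    Do_ob h p ho h1 h2 h3,
    EQbo_ob h p ho hb h1 h2,
    EQb3_ob h p hb h1 h2 h3,
    EQb3o_ob h p ho hb h1 h2 h3,
    gap_ob h p hb h1 h2,
    EQo_ob h p ho h1 h2,
    EQ3_ob h p h1 h2 h3,
    EQ3o_ob h p ho h1 h2 h3,
    PDb_ob h p hb h1 h2 h3,
    PDbo_ob h p ho hb h1 h2 h3,
    Do_diag h p h1 h2 h3,
    EQbo_diag h p h1 h2,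
    EQb3_diag h p h1 h2 h3,
    EQb3o_diag h p h1 h2 h3,
    gap_diag h p h1 h2,
    EQo_diag h p h1 h2,
    EQ3o_diag h p h1 h2 h3,
    PDb_diag h p h1 h2 h3,
    PDbo_diag h p h1 h2 h3,
    OPP_ob h p h1 h2 h3, hqs, hrs]
  ring

/-- **(HCOV) with `o` and `b` behind a cut vertex**, every admissible weight vector: the diagonal
theorem, Harris on the part, and a product of probabilities. -/
theorem HCov_obFar [DecidableEq V] [LinearOrder R] [IsStrictOrderedRing R] (ho : o ∈ L ∨ o = v)
    (hb : b ∈ L ∨ b = v) (h1 : a₁ ∈ Rt ∨ a₁ = v) (h2 : a₂ ∈ Rt ∨ a₂ = v) (h3 : a₃ ∈ Rt ∨ a₃ = v)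
    (hp : IsProbVec p) : HCov p ends o a₁ a₂ a₃ b := by
  unfold HCov
  rw [Gc_obFar_eq h p ho hb h1 h2 h3]
  have hΘ := HCovDiag.Gc_diag_nonneg p hp ends a₁ a₂ a₃ v
  have hH := harris_x1_x2 ends side v o b hp
  have hq : ∀ τ, 0 ≤ patProb ends side v o b p τ := fun τ => prob_nonneg hp _
  have hPQ := prob_nonneg hp (avoidAll ends a₂ {a₁})
  have hD := prob_nonneg hp (PDEvent ends a₁ a₂ a₃)
  have hO := prob_nonneg hp (avoidAll ends a₂ {a₁} ∩ ((connEvent ends a₁ v ∩ connEvent ends a₂ a₃) ∪ (connEvent ends a₂ v ∩ connEvent ends a₁ a₃)))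
  have h2' : (0 : R) ≤ 2 := by norm_num
  refine add_nonneg (mul_nonneg (mul_nonneg (add_nonneg (hq _) (hq _)) (add_nonneg (hq _) (hq _))) hΘ)
    (mul_nonneg (sub_nonneg.2 hH) (mul_nonneg (mul_nonneg (mul_nonneg h2' hPQ) hD) hO))

end OBFar

end CutTwoFar

end Summit.Ventures.PercRepro2
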